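import Summits.Ventures.LatticeQCDFlow.Exactness.Phi4MetropolisPositive
import Summits.Ventures.LatticeQCDFlow.Exactness.ReversiblePositiveTauInt
import Summits.Ventures.LatticeQCDFlow.Exactness.ReversiblePositiveThinning
import Summits.Ventures.LatticeQCDFlow.Exactness.Phi4MetropolisWindowComparison
import HarnessLib

/-!
# The local arm with GAUSSIAN steps decorrelates every observable monotonically: nonnegative, nonincreasing, convex, log-convex autocovariances; every window a floor; per-sweep `τ` pinned; the per-sweep Gaussian-width law

HONEST FRAMING: exact (Metropolis-corrected) sampling algorithms for lattice gauge theory;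
figures of merit are autocorrelation/cost numbers at stated couplings and volumes; no
continuum-physics claim.  (SCALAR calibration rung S0-A: not a gauge result.)

Venture `LatticeQCDFlow` (cell pub-lqcd), topic `Exactness`; FANOUT row 2 (`s0-phi4`, LOCAL arm:
random-site single-site Metropolis `K = metroScan J λ N(0,v)` on lattice φ⁴ over `ℝ^Λ`).  NEW WORK of
the cell: the lattice instances of `Exactness/ReversiblePositive{,TauInt,Thinning}.lean` for the local
arm, whose hypothesis (pos) is `Exactness/Phi4MetropolisPositive.lean`
(`metroScan_gaussian_positive_poly`: with Gaussian steps the scan is a positive operator on `PolyObs`);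
the width comparison enters through gen-18's `gaussianPDFReal_le_mul_of_le`
(`N(0,v₁) ≤ √(v₂/v₁) N(0,v₂)`) and `metroScan_dirichlet_le_of_stepLaw_le`.  Nothing is cited as a
fact.  Printed counterparts NAMED ONLY: Rudolf–Ullrich 2013 (positivity of Metropolis with positive
proposals); Geyer 1992 §3 (monotone sequence estimators); Sokal 1997 (windowing).

## Setting

Coercive action `ε Σφ² − K' ≤ S` (every `λ > 0`, real `J`); Gaussian step law `N(0, v)`, `v ≠ 0`;
`f ∈ PolyObs` (magnetisation, energy, all polynomial observables), `g = f − ⟨f⟩`,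
`C(k) = ∫ g (Kᵏ g) e^{−S}`, `P = C(0)`, `ρ(k) = C(k)/P`; `V = |Λ| = n + 1` proposals per sweep,
`τ_sweep` the integrated autocorrelation time of the chain observed once per sweep (`k ↦ ρ(Vk)`).

## What is proved

* **`metropolisScan_gaussian_autocov_nonneg_antitone`** — `0 ≤ C(k+1) ≤ C(k)` for EVERY lag and
  every `f ∈ PolyObs`: with Gaussian steps no observable of the local arm is ever anti-correlated
  with its past, and the autocorrelation function decreases monotonically;
* **`metropolisScan_gaussian_autocov_convex_logConvex`** — `C(k+1) − C(k+2) ≤ C(k) − C(k+1)` and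
  `C(k+1)² ≤ C(k) C(k+2)`; **`metropolisScan_gaussian_autocorr_pow_le`** — `ρ(1)^k ≤ ρ(k)`;
* **`metropolisScan_gaussian_window_le_tauInt`** — summable series ⇒ EVERY window is a floor,
  `τ_W ≤ τ_int` for all `W`, and `½ + ρ(1) ≤ τ_int` (no antithetic gain for any observable);
* **`metropolisScan_gaussian_sweep_pinned`** — `(τ + ½)/V − ½ ≤ τ_sweep ≤ ½ + (τ − ½)/V`
  (`τ` per proposal, `V = n + 1`): the per-sweep and per-proposal columns determine each other to
  within `1 − 1/V`;
* **`metropolisScan_gaussian_sweep_width_law`** — THE PER-SWEEP GAUSSIAN-WIDTH LAW: `0 < v₁ ≤ v₂` ⇒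
  `τ_sweep[v₂] + ½ ≤ √(v₂/v₁) · (τ_sweep[v₁] + ½) + (1 − 1/V)` — gen-18's per-proposal width law
  survives thinning to sweeps up to one sweep (the positivity of the wider Gaussian scan is what
  makes the per-sweep transfer legitimate).

NOT CLAIMED: any of this for the uniform-window step law (the scan need not be positive); the
ordered sweep; `ρ < 1`/summability for any run (hypotheses); any number for any run.
-/

namespace Summit.Ventures.LatticeQCDFlow.Exactness

open Real MeasureTheory Filter Finset Topology ProbabilityTheory
open scoped NNReal
open Summit.Ventures.LatticeQCDFlow.Scoring

section Lattice

variable {n : ℕ}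

/-- `f − c ∈ PolyObs` (local copy of `polyObs_sub_const` from `Phi4HMCPolyObsFloor`). -/
private theorem polyObs_sub_const'' {f : (Fin (n + 1) → ℝ) → ℝ} (hf : PolyObs f) (c : ℝ) :
    PolyObs (fun φ => f φ - c) := by
  have h := polyObs_add_mul hf (polyObs_const 1) (-c)
  have e : (fun φ => f φ + -c * (1 : ℝ)) = fun φ => f φ - c := funext fun φ => by ring
  rw [e] at h
  exact h

/-- **MONOTONE DECORRELATION OF THE LOCAL ARM WITH GAUSSIAN STEPS.**  For every `f ∈ PolyObs` and
every lag `k`:  `0 ≤ C(k+1) ≤ C(k)`, `C(k) = ∫ (f − ⟨f⟩)(Kᵏ(f − ⟨f⟩)) e^{−S}`. -/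
theorem metropolisScan_gaussian_autocov_nonneg_antitone {J : Fin (n + 1) → Fin (n + 1) → ℝ}
    {lam ε K' : ℝ}
    (hε : 0 < ε) (hS : ∀ φ : Fin (n + 1) → ℝ, ε * ∑ w, φ w ^ 2 - K' ≤ latticePhi4Action J lam φ)
    {v : ℝ≥0} (hv : v ≠ 0) {f : (Fin (n + 1) → ℝ) → ℝ} (hf : PolyObs f) (k : ℕ) :
    0 ≤ ∫ φ, (f φ - gibbsExpect J lam f)
        * ((metroScan J lam (gaussianPDFReal 0 v))^[k + 1] (fun ψ => f ψ - gibbsExpect J lam f)) φ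
        * gibbsWeight J lam φ ∧
    ∫ φ, (f φ - gibbsExpect J lam f)
        * ((metroScan J lam (gaussianPDFReal 0 v))^[k + 1] (fun ψ => f ψ - gibbsExpect J lam f)) φ
        * gibbsWeight J lam φ
      ≤ ∫ φ, (f φ - gibbsExpect J lam f)
        * ((metroScan J lam (gaussianPDFReal 0 v))^[k] (fun ψ => f ψ - gibbsExpect J lam f)) φ
        * gibbsWeight J lam φ := by
  have hg : PolyObs (fun ψ => f ψ - gibbsExpect J lam f) := polyObs_sub_const'' hf _
  have hρ0 := fun u => gaussianPDFReal_nonneg 0 v u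
  have hρm := measurable_gaussianPDFReal 0 v
  have hρi := integrable_gaussianPDFReal 0 v
  have hρ1 := integral_gaussianPDFReal_eq_one 0 hv
  have hρs := gaussianPDFReal_zero_neg v
  have hρmom := gaussianPDFReal_moments hv
  refine ⟨RevOp.autocov_nonneg_of_pos (μ := volume) (A := PolyObs)
      (K := metroScan J lam (gaussianPDFReal 0 v)) (w := gibbsWeight J lam)
      (fun φ => (gibbsWeight_pos J lam φ).le)
      (fun f hf => polyObs_metroScan J lam hρ0 hρm hρmom hf)
      (fun f h hf hh => metroScan_reversible_poly hε hS hρ0 hρm hρi hρ1 hρs hρmom hf hh)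
      (fun f hf => metroScan_gaussian_positive_poly hε hS hv hf) hg (k + 1),
    RevOp.autocov_succ_le_of_pos (μ := volume) (A := PolyObs)
      (K := metroScan J lam (gaussianPDFReal 0 v)) (w := gibbsWeight J lam)
      (fun φ => (gibbsWeight_pos J lam φ).le)
      (fun f h hf hh => polyObs_integrable_mul_mul_gibbsWeight hε hS hf hh)
      (fun f h c hf hh => polyObs_add_mul hf hh c)
      (fun f hf => polyObs_metroScan J lam hρ0 hρm hρmom hf)
      (fun f h c hf hh x => metroScan_add_mul_poly J lam hρ0 hρm hρmom hf hh c x)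
      (fun f h hf hh => metroScan_reversible_poly hε hS hρ0 hρm hρi hρ1 hρs hρmom hf hh)
      (fun f hf => metroScan_contraction_poly hε hS hρ0 hρm hρi hρ1 hρs hρmom hf)
      (fun f hf => metroScan_gaussian_positive_poly hε hS hv hf) hg k⟩

/-- **CONVEX and LOG-CONVEX autocovariances** of every `f ∈ PolyObs` under the Gaussian local arm:
`C(k+1) − C(k+2) ≤ C(k) − C(k+1)` and `C(k+1)² ≤ C(k) C(k+2)`. -/
theorem metropolisScan_gaussian_autocov_convex_logConvex {J : Fin (n + 1) → Fin (n + 1) → ℝ}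
    {lam ε K' : ℝ}
    (hε : 0 < ε) (hS : ∀ φ : Fin (n + 1) → ℝ, ε * ∑ w, φ w ^ 2 - K' ≤ latticePhi4Action J lam φ)
    {v : ℝ≥0} (hv : v ≠ 0) {f : (Fin (n + 1) → ℝ) → ℝ} (hf : PolyObs f) (k : ℕ) :
    (∫ φ, (f φ - gibbsExpect J lam f)
        * ((metroScan J lam (gaussianPDFReal 0 v))^[k + 1] (fun ψ => f ψ - gibbsExpect J lam f)) φ
        * gibbsWeight J lam φ)
      - ∫ φ, (f φ - gibbsExpect J lam f)
        * ((metroScan J lam (gaussianPDFReal 0 v))^[k + 2] (fun ψ => f ψ - gibbsExpect J lam f)) φ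
        * gibbsWeight J lam φ
      ≤ (∫ φ, (f φ - gibbsExpect J lam f)
        * ((metroScan J lam (gaussianPDFReal 0 v))^[k] (fun ψ => f ψ - gibbsExpect J lam f)) φ
        * gibbsWeight J lam φ)
      - ∫ φ, (f φ - gibbsExpect J lam f)
        * ((metroScan J lam (gaussianPDFReal 0 v))^[k + 1] (fun ψ => f ψ - gibbsExpect J lam f)) φ
        * gibbsWeight J lam φ ∧
    (∫ φ, (f φ - gibbsExpect J lam f)
        * ((metroScan J lam (gaussianPDFReal 0 v))^[k + 1] (fun ψ => f ψ - gibbsExpect J lam f)) φ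
        * gibbsWeight J lam φ) ^ 2
      ≤ (∫ φ, (f φ - gibbsExpect J lam f)
        * ((metroScan J lam (gaussianPDFReal 0 v))^[k] (fun ψ => f ψ - gibbsExpect J lam f)) φ
        * gibbsWeight J lam φ)
        * ∫ φ, (f φ - gibbsExpect J lam f)
        * ((metroScan J lam (gaussianPDFReal 0 v))^[k + 2] (fun ψ => f ψ - gibbsExpect J lam f)) φ
        * gibbsWeight J lam φ := by
  have hg : PolyObs (fun ψ => f ψ - gibbsExpect J lam f) := polyObs_sub_const'' hf _
  have hρ0 := fun u => gaussianPDFReal_nonneg 0 v u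
  have hρm := measurable_gaussianPDFReal 0 v
  have hρi := integrable_gaussianPDFReal 0 v
  have hρ1 := integral_gaussianPDFReal_eq_one 0 hv
  have hρs := gaussianPDFReal_zero_neg v
  have hρmom := gaussianPDFReal_moments hv
  exact ⟨RevOp.autocov_convex_of_pos (μ := volume) (A := PolyObs)
      (K := metroScan J lam (gaussianPDFReal 0 v)) (w := gibbsWeight J lam)
      (fun φ => (gibbsWeight_pos J lam φ).le)
      (fun f h hf hh => polyObs_integrable_mul_mul_gibbsWeight hε hS hf hh)
      (fun f h c hf hh => polyObs_add_mul hf hh c)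
      (fun f hf => polyObs_metroScan J lam hρ0 hρm hρmom hf)
      (fun f h c hf hh x => metroScan_add_mul_poly J lam hρ0 hρm hρmom hf hh c x)
      (fun f h hf hh => metroScan_reversible_poly hε hS hρ0 hρm hρi hρ1 hρs hρmom hf hh)
      (fun f hf => metroScan_gaussian_positive_poly hε hS hv hf) hg k,
    RevOp.autocov_logConvex_of_pos (μ := volume) (A := PolyObs)
      (K := metroScan J lam (gaussianPDFReal 0 v)) (w := gibbsWeight J lam)
      (fun φ => (gibbsWeight_pos J lam φ).le)
      (fun f h hf hh => polyObs_integrable_mul_mul_gibbsWeight hε hS hf hh)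
      (fun f h c hf hh => polyObs_add_mul hf hh c)
      (fun f hf => polyObs_metroScan J lam hρ0 hρm hρmom hf)
      (fun f h c hf hh x => metroScan_add_mul_poly J lam hρ0 hρm hρmom hf hh c x)
      (fun f h hf hh => metroScan_reversible_poly hε hS hρ0 hρm hρi hρ1 hρs hρmom hf hh)
      (fun f hf => metroScan_gaussian_positive_poly hε hS hv hf) hg k⟩

/-- **`ρ(1)^(k+1) ≤ ρ(k+1)`**: with Gaussian steps the local arm decorrelates no observable faster than
geometrically at that observable's own lag-one rate. -/
theorem metropolisScan_gaussian_autocorr_pow_le {J : Fin (n + 1) → Fin (n + 1) → ℝ} {lam ε K' : ℝ}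
    (hε : 0 < ε) (hS : ∀ φ : Fin (n + 1) → ℝ, ε * ∑ w, φ w ^ 2 - K' ≤ latticePhi4Action J lam φ)
    {v : ℝ≥0} (hv : v ≠ 0) {f : (Fin (n + 1) → ℝ) → ℝ} (hf : PolyObs f) (k : ℕ) :
    ((∫ φ, (f φ - gibbsExpect J lam f)
        * metroScan J lam (gaussianPDFReal 0 v) (fun ψ => f ψ - gibbsExpect J lam f) φ
        * gibbsWeight J lam φ) / ∫ φ, (f φ - gibbsExpect J lam f) ^ 2 * gibbsWeight J lam φ) ^ (k + 1)
      ≤ (∫ φ, (f φ - gibbsExpect J lam f)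
        * ((metroScan J lam (gaussianPDFReal 0 v))^[k + 1] (fun ψ => f ψ - gibbsExpect J lam f)) φ
        * gibbsWeight J lam φ) / ∫ φ, (f φ - gibbsExpect J lam f) ^ 2 * gibbsWeight J lam φ := by
  have hg : PolyObs (fun ψ => f ψ - gibbsExpect J lam f) := polyObs_sub_const'' hf _
  have hρ0 := fun u => gaussianPDFReal_nonneg 0 v u
  have hρm := measurable_gaussianPDFReal 0 v
  have hρi := integrable_gaussianPDFReal 0 v
  have hρ1 := integral_gaussianPDFReal_eq_one 0 hv
  have hρs := gaussianPDFReal_zero_neg v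
  have hρmom := gaussianPDFReal_moments hv
  exact RevOp.autocorr_pow_le_of_pos (μ := volume) (A := PolyObs)
    (K := metroScan J lam (gaussianPDFReal 0 v)) (w := gibbsWeight J lam)
    (fun φ => (gibbsWeight_pos J lam φ).le)
    (fun f h hf hh => polyObs_integrable_mul_mul_gibbsWeight hε hS hf hh)
    (fun f h c hf hh => polyObs_add_mul hf hh c)
    (fun f hf => polyObs_metroScan J lam hρ0 hρm hρmom hf)
    (fun f h c hf hh x => metroScan_add_mul_poly J lam hρ0 hρm hρmom hf hh c x)
    (fun f h hf hh => metroScan_reversible_poly hε hS hρ0 hρm hρi hρ1 hρs hρmom hf hh)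
    (fun f hf => metroScan_gaussian_positive_poly hε hS hv hf) hg k

/-- **EVERY WINDOW IS A FLOOR; NO ANTITHETIC GAIN.**  If the normalised series of `f ∈ PolyObs` under
the Gaussian local arm is summable, then `τ_W ≤ τ_int` for EVERY cut-off `W` and
`½ ≤ ½ + ρ(1) ≤ τ_int`. -/
theorem metropolisScan_gaussian_window_le_tauInt {J : Fin (n + 1) → Fin (n + 1) → ℝ} {lam ε K' : ℝ}
    (hε : 0 < ε) (hS : ∀ φ : Fin (n + 1) → ℝ, ε * ∑ w, φ w ^ 2 - K' ≤ latticePhi4Action J lam φ)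
    {v : ℝ≥0} (hv : v ≠ 0) {f : (Fin (n + 1) → ℝ) → ℝ} (hf : PolyObs f)
    (hs : Summable fun k => (∫ φ, (f φ - gibbsExpect J lam f)
        * ((metroScan J lam (gaussianPDFReal 0 v))^[k + 1] (fun ψ => f ψ - gibbsExpect J lam f)) φ
        * gibbsWeight J lam φ) / ∫ φ, (f φ - gibbsExpect J lam f) ^ 2 * gibbsWeight J lam φ)
    (W : ℕ) :
    tauIntWindow (fun k => (∫ φ, (f φ - gibbsExpect J lam f)
        * ((metroScan J lam (gaussianPDFReal 0 v))^[k] (fun ψ => f ψ - gibbsExpect J lam f)) φ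
        * gibbsWeight J lam φ) / ∫ φ, (f φ - gibbsExpect J lam f) ^ 2 * gibbsWeight J lam φ) W
      ≤ tauInt (fun k => (∫ φ, (f φ - gibbsExpect J lam f)
        * ((metroScan J lam (gaussianPDFReal 0 v))^[k] (fun ψ => f ψ - gibbsExpect J lam f)) φ
        * gibbsWeight J lam φ) / ∫ φ, (f φ - gibbsExpect J lam f) ^ 2 * gibbsWeight J lam φ) ∧
    1 / 2 + (∫ φ, (f φ - gibbsExpect J lam f)
        * metroScan J lam (gaussianPDFReal 0 v) (fun ψ => f ψ - gibbsExpect J lam f) φ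
        * gibbsWeight J lam φ) / (∫ φ, (f φ - gibbsExpect J lam f) ^ 2 * gibbsWeight J lam φ)
      ≤ tauInt (fun k => (∫ φ, (f φ - gibbsExpect J lam f)
        * ((metroScan J lam (gaussianPDFReal 0 v))^[k] (fun ψ => f ψ - gibbsExpect J lam f)) φ
        * gibbsWeight J lam φ) / ∫ φ, (f φ - gibbsExpect J lam f) ^ 2 * gibbsWeight J lam φ) := by
  have hg : PolyObs (fun ψ => f ψ - gibbsExpect J lam f) := polyObs_sub_const'' hf _
  have hρ0 := fun u => gaussianPDFReal_nonneg 0 v u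
  have hρm := measurable_gaussianPDFReal 0 v
  have hρi := integrable_gaussianPDFReal 0 v
  have hρ1 := integral_gaussianPDFReal_eq_one 0 hv
  have hρs := gaussianPDFReal_zero_neg v
  have hρmom := gaussianPDFReal_moments hv
  refine ⟨RevOp.tauIntWindow_le_tauInt_of_pos (μ := volume) (A := PolyObs)
      (K := metroScan J lam (gaussianPDFReal 0 v)) (w := gibbsWeight J lam)
      (fun φ => (gibbsWeight_pos J lam φ).le)
      (fun f hf => polyObs_metroScan J lam hρ0 hρm hρmom hf)
      (fun f h hf hh => metroScan_reversible_poly hε hS hρ0 hρm hρi hρ1 hρs hρmom hf hh)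
      (fun f hf => metroScan_gaussian_positive_poly hε hS hv hf) hg hs W, ?_⟩
  exact (RevOp.half_le_tauInt_of_pos (μ := volume) (A := PolyObs)
      (K := metroScan J lam (gaussianPDFReal 0 v)) (w := gibbsWeight J lam)
      (fun φ => (gibbsWeight_pos J lam φ).le)
      (fun f hf => polyObs_metroScan J lam hρ0 hρm hρmom hf)
      (fun f h hf hh => metroScan_reversible_poly hε hS hρ0 hρm hρi hρ1 hρs hρmom hf hh)
      (fun f hf => metroScan_gaussian_positive_poly hε hS hv hf) hg hs).2

/-- **PER-SWEEP `τ` IS PINNED BY THE PER-PROPOSAL `τ`** (`V = n + 1` proposals per sweep): for every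
`f ∈ PolyObs` with `Var f > 0` and summable series under the Gaussian local arm,
`(τ + ½)/V − ½ ≤ τ_sweep ≤ ½ + (τ − ½)/V`. -/
theorem metropolisScan_gaussian_sweep_pinned {J : Fin (n + 1) → Fin (n + 1) → ℝ} {lam ε K' : ℝ}
    (hε : 0 < ε) (hS : ∀ φ : Fin (n + 1) → ℝ, ε * ∑ w, φ w ^ 2 - K' ≤ latticePhi4Action J lam φ)
    {v : ℝ≥0} (hv : v ≠ 0) {f : (Fin (n + 1) → ℝ) → ℝ} (hf : PolyObs f)
    (hP : 0 < ∫ φ, (f φ - gibbsExpect J lam f) ^ 2 * gibbsWeight J lam φ)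
    (hs : Summable fun k => (∫ φ, (f φ - gibbsExpect J lam f)
        * ((metroScan J lam (gaussianPDFReal 0 v))^[k + 1] (fun ψ => f ψ - gibbsExpect J lam f)) φ
        * gibbsWeight J lam φ) / ∫ φ, (f φ - gibbsExpect J lam f) ^ 2 * gibbsWeight J lam φ) :
    (tauInt (fun k => (∫ φ, (f φ - gibbsExpect J lam f)
        * ((metroScan J lam (gaussianPDFReal 0 v))^[k] (fun ψ => f ψ - gibbsExpect J lam f)) φ
        * gibbsWeight J lam φ) / ∫ φ, (f φ - gibbsExpect J lam f) ^ 2 * gibbsWeight J lam φ)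
        + 1 / 2) / ((n : ℕ) + 1 : ℕ) - 1 / 2
      ≤ tauInt (fun k => (∫ φ, (f φ - gibbsExpect J lam f)
        * ((metroScan J lam (gaussianPDFReal 0 v))^[(n + 1) * k]
            (fun ψ => f ψ - gibbsExpect J lam f)) φ
        * gibbsWeight J lam φ) / ∫ φ, (f φ - gibbsExpect J lam f) ^ 2 * gibbsWeight J lam φ) ∧
    tauInt (fun k => (∫ φ, (f φ - gibbsExpect J lam f)
        * ((metroScan J lam (gaussianPDFReal 0 v))^[(n + 1) * k]
            (fun ψ => f ψ - gibbsExpect J lam f)) φ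
        * gibbsWeight J lam φ) / ∫ φ, (f φ - gibbsExpect J lam f) ^ 2 * gibbsWeight J lam φ)
      ≤ 1 / 2 + (tauInt (fun k => (∫ φ, (f φ - gibbsExpect J lam f)
        * ((metroScan J lam (gaussianPDFReal 0 v))^[k] (fun ψ => f ψ - gibbsExpect J lam f)) φ
        * gibbsWeight J lam φ) / ∫ φ, (f φ - gibbsExpect J lam f) ^ 2 * gibbsWeight J lam φ)
        - 1 / 2) / ((n : ℕ) + 1 : ℕ) := by
  have hg : PolyObs (fun ψ => f ψ - gibbsExpect J lam f) := polyObs_sub_const'' hf _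
  have hρ0 := fun u => gaussianPDFReal_nonneg 0 v u
  have hρm := measurable_gaussianPDFReal 0 v
  have hρi := integrable_gaussianPDFReal 0 v
  have hρ1 := integral_gaussianPDFReal_eq_one 0 hv
  have hρs := gaussianPDFReal_zero_neg v
  have hρmom := gaussianPDFReal_moments hv
  exact RevOp.thinned_tauInt_pinned_of_pos (μ := volume) (A := PolyObs)
    (K := metroScan J lam (gaussianPDFReal 0 v)) (w := gibbsWeight J lam)
    (fun φ => (gibbsWeight_pos J lam φ).le)
    (fun f h hf hh => polyObs_integrable_mul_mul_gibbsWeight hε hS hf hh)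
    (fun f h c hf hh => polyObs_add_mul hf hh c)
    (fun f hf => polyObs_metroScan J lam hρ0 hρm hρmom hf)
    (fun f h c hf hh x => metroScan_add_mul_poly J lam hρ0 hρm hρmom hf hh c x)
    (fun f h hf hh => metroScan_reversible_poly hε hS hρ0 hρm hρi hρ1 hρs hρmom hf hh)
    (fun f hf => metroScan_contraction_poly hε hS hρ0 hρm hρi hρ1 hρs hρmom hf)
    (fun f hf => metroScan_gaussian_positive_poly hε hS hv hf) hg hP (Nat.succ_le_succ (Nat.zero_le n))
    hs

/-- **THE PER-SWEEP GAUSSIAN-WIDTH LAW OF THE LOCAL ARM.**  Gaussian steps `N(0,v₁)`, `N(0,v₂)`,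
`0 < v₁ ≤ v₂`; `f ∈ PolyObs` with `Var f > 0`; series summable (full under both widths, per sweep
under `v₁`).  Then, per sweep of `V = n + 1` proposals:
`τ_sweep[v₂] + ½ ≤ √(v₂/v₁) · (τ_sweep[v₁] + ½) + (1 − 1/V)`. -/
theorem metropolisScan_gaussian_sweep_width_law {J : Fin (n + 1) → Fin (n + 1) → ℝ} {lam ε K' : ℝ}
    (hε : 0 < ε) (hS : ∀ φ : Fin (n + 1) → ℝ, ε * ∑ w, φ w ^ 2 - K' ≤ latticePhi4Action J lam φ)
    {v₁ v₂ : ℝ≥0} (hv₁ : v₁ ≠ 0) (h12 : v₁ ≤ v₂) {f : (Fin (n + 1) → ℝ) → ℝ} (hf : PolyObs f)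
    (hP : 0 < ∫ φ, (f φ - gibbsExpect J lam f) ^ 2 * gibbsWeight J lam φ)
    (hs₁ : Summable fun k => (∫ φ, (f φ - gibbsExpect J lam f)
        * ((metroScan J lam (gaussianPDFReal 0 v₁))^[k + 1] (fun ψ => f ψ - gibbsExpect J lam f)) φ
        * gibbsWeight J lam φ) / ∫ φ, (f φ - gibbsExpect J lam f) ^ 2 * gibbsWeight J lam φ)
    (hs₁V : Summable fun k => (∫ φ, (f φ - gibbsExpect J lam f)
        * ((metroScan J lam (gaussianPDFReal 0 v₁))^[(n + 1) * (k + 1)]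
            (fun ψ => f ψ - gibbsExpect J lam f)) φ
        * gibbsWeight J lam φ) / ∫ φ, (f φ - gibbsExpect J lam f) ^ 2 * gibbsWeight J lam φ)
    (hs₂ : Summable fun k => (∫ φ, (f φ - gibbsExpect J lam f)
        * ((metroScan J lam (gaussianPDFReal 0 v₂))^[k + 1] (fun ψ => f ψ - gibbsExpect J lam f)) φ
        * gibbsWeight J lam φ) / ∫ φ, (f φ - gibbsExpect J lam f) ^ 2 * gibbsWeight J lam φ) :
    tauInt (fun k => (∫ φ, (f φ - gibbsExpect J lam f)
        * ((metroScan J lam (gaussianPDFReal 0 v₂))^[(n + 1) * k]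
            (fun ψ => f ψ - gibbsExpect J lam f)) φ
        * gibbsWeight J lam φ) / ∫ φ, (f φ - gibbsExpect J lam f) ^ 2 * gibbsWeight J lam φ) + 1 / 2
      ≤ Real.sqrt ((v₂ : ℝ) / v₁) * (tauInt (fun k => (∫ φ, (f φ - gibbsExpect J lam f)
        * ((metroScan J lam (gaussianPDFReal 0 v₁))^[(n + 1) * k]
            (fun ψ => f ψ - gibbsExpect J lam f)) φ
        * gibbsWeight J lam φ) / ∫ φ, (f φ - gibbsExpect J lam f) ^ 2 * gibbsWeight J lam φ) + 1 / 2)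
        + (1 - 1 / ((n : ℕ) + 1 : ℕ)) := by
  have hv₂ : v₂ ≠ 0 := fun h => hv₁ (nonpos_iff_eq_zero.1 (h ▸ h12))
  have hv1 : (0 : ℝ) < v₁ := NNReal.coe_pos.2 (pos_iff_ne_zero.2 hv₁)
  have hv2 : (0 : ℝ) < v₂ := NNReal.coe_pos.2 (pos_iff_ne_zero.2 hv₂)
  have hg : PolyObs (fun ψ => f ψ - gibbsExpect J lam f) := polyObs_sub_const'' hf _
  have hρ₁0 := fun u => gaussianPDFReal_nonneg 0 v₁ u
  have hρ₁m := measurable_gaussianPDFReal 0 v₁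
  have hρ₁i := integrable_gaussianPDFReal 0 v₁
  have hρ₁1 := integral_gaussianPDFReal_eq_one 0 hv₁
  have hρ₁s := gaussianPDFReal_zero_neg v₁
  have hρ₁mom := gaussianPDFReal_moments hv₁
  have hρ₂0 := fun u => gaussianPDFReal_nonneg 0 v₂ u
  have hρ₂m := measurable_gaussianPDFReal 0 v₂
  have hρ₂i := integrable_gaussianPDFReal 0 v₂
  have hρ₂1 := integral_gaussianPDFReal_eq_one 0 hv₂
  have hρ₂s := gaussianPDFReal_zero_neg v₂
  have hρ₂mom := gaussianPDFReal_moments hv₂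
  exact RevOp.thinned_tauInt_le_of_dirichlet_le_mul_of_pos (μ := volume) (A := PolyObs)
    (K := metroScan J lam (gaussianPDFReal 0 v₁)) (K' := metroScan J lam (gaussianPDFReal 0 v₂))
    (w := gibbsWeight J lam)
    (fun φ => (gibbsWeight_pos J lam φ).le)
    (fun f h hf hh => polyObs_integrable_mul_mul_gibbsWeight hε hS hf hh)
    (fun f h c hf hh => polyObs_add_mul hf hh c)
    (fun f hf => polyObs_metroScan J lam hρ₁0 hρ₁m hρ₁mom hf)
    (fun f h c hf hh x => metroScan_add_mul_poly J lam hρ₁0 hρ₁m hρ₁mom hf hh c x)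
    (fun f h hf hh => metroScan_reversible_poly hε hS hρ₁0 hρ₁m hρ₁i hρ₁1 hρ₁s hρ₁mom hf hh)
    (fun f hf => metroScan_contraction_poly hε hS hρ₁0 hρ₁m hρ₁i hρ₁1 hρ₁s hρ₁mom hf)
    (fun f hf => polyObs_metroScan J lam hρ₂0 hρ₂m hρ₂mom hf)
    (fun f h c hf hh x => metroScan_add_mul_poly J lam hρ₂0 hρ₂m hρ₂mom hf hh c x)
    (fun f h hf hh => metroScan_reversible_poly hε hS hρ₂0 hρ₂m hρ₂i hρ₂1 hρ₂s hρ₂mom hf hh)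
    (fun f hf => metroScan_contraction_poly hε hS hρ₂0 hρ₂m hρ₂i hρ₂1 hρ₂s hρ₂mom hf)
    (fun f hf => metroScan_gaussian_positive_poly hε hS hv₂ hf)
    (Real.sqrt_pos.2 (div_pos hv2 hv1))
    (fun v hv => metroScan_dirichlet_le_of_stepLaw_le hε hS hρ₁0 hρ₁m hρ₁i hρ₁1 hρ₁s hρ₁mom
      hρ₂0 hρ₂m hρ₂i hρ₂1 hρ₂s hρ₂mom (gaussianPDFReal_le_mul_of_le hv₁ h12) hv)
    hg hP (Nat.succ_le_succ (Nat.zero_le n)) hs₁ hs₁V hs₂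

end Lattice

end Summit.Ventures.LatticeQCDFlow.Exactness
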